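import Literature.NumberTheory.Adeles.CompactSubgroupStabilisesLattice
import HarnessLib

/-!
# The `ℤ`-lattice of a finite-adelic matrix: `GL_n(𝔸_{ℚ,f}) ↷ {full lattices of ℚⁿ}` (carrier file)

Topic `Literature/NumberTheory/Adeles`; namespace `Literature.NumberTheory.Adeles`.  ONE definition with a body
(`latticeOfGL`) and bookkeeping theorems; no named fact, no instance, no `sorry`.  Companions (theorems only):
`FiniteAdeleLatticeOfGLDecomposition` (`Λ_a = γ ℤⁿ`, `GL_n(𝔸_{ℚ,f}) = GL_n(ℚ)·GL_n(ℤ̂)`, `Λ_a = Λ_b ↔ a⁻¹ b ∈ GL_n(ℤ̂)`,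
stabilisers) and `FiniteAdeleLatticeOfGLLevel` (`Λ_a / NΛ_a ≃ (ℤ/N)ⁿ` through `q ↦ a⁻¹ q`).

For `a ∈ GL_n(𝔸_{ℚ,f})` (`𝔸_{ℚ,f} = finAdeleQ`, `ℤ̂ = 𝒪̂ = integralFiniteAdeles ℚ`) the **lattice of `a`** is
`Λ_a = ℚⁿ ∩ a·ℤ̂ⁿ = {q ∈ ℚⁿ | a⁻¹ q ∈ ℤ̂ⁿ}` ([Milne2005ShimuraVarieties] §4 pp. 48–49 «`g ↦ gΛ`; … `V/Λ ≅ V(𝔸_f)/Λ̂`»,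
proof of Prop. 4.20 / Thm. 6.11; [Deligne1971TravauxShimura] 4.16–4.20; [PlatonovRapinchuk1994] §8.1).  Proved here:

* `mem_latticeOfGL_iff_exists` — `Λ_a = ℚⁿ ∩ a ℤ̂ⁿ`; `mem_latticeOfGL_one_iff` — `Λ_1 = ℤⁿ` (`ℚ ∩ ℤ̂ = ℤ`);
* `latticeOfGL_mul_eq_of_mem` — `Λ_{a u} = Λ_a` for `u ∈ GL_n(ℤ̂)`;
* `mem_latticeOfGL_map_mul_iff` / `latticeOfGL_map_mul` — `Λ_{γ a} = γ • Λ_a` for `γ ∈ GL_n(ℚ)`, and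
  `mem_latticeOfGL_map_iff_exists` — `Λ_γ = γ ℤⁿ`;
* `exists_nat_mul_entries_mem`, `natCast_smul_single_mem_latticeOfGL`, `exists_int_cast_eq_natCast_mul_of_mem_latticeOfGL` —
  a common denominator `N` of `a, a⁻¹` gives `N eᵢ ∈ Λ_a` and `N Λ_a ⊆ ℤⁿ` (so `Λ_a` is a full lattice).

Cell `hodgecm-mathlib` (D-0151), #60 road (row I-7 `SiegelS1`), leaf R60-19 (MUMFORD-LINE-SPEC §3 step 5 / §5 `stub_latticeDictionary`):
the Mathlib-level lattice dictionary behind «`[J, a] ↦ (ℂ^{2g}_J/Λ_a, ψ_δ, a mod N)`».  Banked generic leaf; HC_CM is proved only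
modulo the printed citations until rung 0 closes; no floor change.

## References
* [Milne2005ShimuraVarieties] J. S. Milne, *Introduction to Shimura varieties* (2005), §4 pp. 48–49 (lattices and `𝔸_f`),
  Prop. 4.20, proof of Thm. 6.11.
* [Deligne1971TravauxShimura] P. Deligne, *Travaux de Shimura* (1971), 4.16–4.20 pp. 150–152.
* [PlatonovRapinchuk1994] V. Platonov, A. Rapinchuk, *Algebraic groups and number theory* (1994), §8.1 (class number of `GL_n`).
-/

set_option autoImplicit false

noncomputable section

open scoped Matrix
open NumberField IsDedekindDomain Matrix
open Literature.NumberTheory.Automorphic (integralFiniteAdeles mem_integralFiniteAdeles_iff)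
open Literature.AlgebraicGeometry.ModuliOfAbelianVarieties (finAdeleQ)

namespace Literature.NumberTheory.Adeles

variable {n : Type} [Fintype n] [DecidableEq n]

/-! ### §1. The lattice `Λ_a = ℚⁿ ∩ a ℤ̂ⁿ` -/

/-- **The `ℤ`-lattice of a finite-adelic matrix**: `Λ_a = {q ∈ ℚⁿ | a⁻¹ q ∈ ℤ̂ⁿ} = ℚⁿ ∩ a·ℤ̂ⁿ` for
`a ∈ GL_n(𝔸_{ℚ,f})` («`gΛ` is the lattice with `(gΛ) ⊗ ℤ̂ = g(Λ ⊗ ℤ̂)`»).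
[cite: Milne2005ShimuraVarieties, §4 pp. 48–49] [cite: Deligne1971TravauxShimura, 4.16 p. 150] -/
def latticeOfGL (a : GL n finAdeleQ) : Submodule ℤ (n → ℚ) where
  carrier := {q | ∀ i, (((a⁻¹ : GL n finAdeleQ) : Matrix n n finAdeleQ) *ᵥ
    (⇑(algebraMap ℚ finAdeleQ) ∘ q)) i ∈ integralFiniteAdeles ℚ}
  add_mem' {q q'} hq hq' i := by
    have h : (⇑(algebraMap ℚ finAdeleQ) ∘ (q + q')) =
        (⇑(algebraMap ℚ finAdeleQ) ∘ q) + (⇑(algebraMap ℚ finAdeleQ) ∘ q') := by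
      funext j; simp only [Function.comp_apply, Pi.add_apply, map_add]
    simp only [h, Matrix.mulVec_add, Pi.add_apply]
    exact add_mem (hq i) (hq' i)
  zero_mem' i := by
    have h : (⇑(algebraMap ℚ finAdeleQ) ∘ (0 : n → ℚ)) = 0 := by
      funext j; simp only [Function.comp_apply, Pi.zero_apply, map_zero]
    simp only [h, Matrix.mulVec_zero, Pi.zero_apply]
    exact zero_mem _
  smul_mem' z q hq i := by
    have h : (⇑(algebraMap ℚ finAdeleQ) ∘ (z • q)) =
        algebraMap ℚ finAdeleQ (z : ℚ) • (⇑(algebraMap ℚ finAdeleQ) ∘ q) := by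
      funext j
      simp only [Function.comp_apply, Pi.smul_apply]
      rw [zsmul_eq_mul, map_mul, map_intCast, smul_eq_mul]
    simp only [h, Matrix.mulVec_smul, Pi.smul_apply, smul_eq_mul]
    exact mul_mem (algebraMap_intCast_mem_integralFiniteAdeles z) (hq i)

/-- Membership in `Λ_a`: `a⁻¹ q` has coordinates in `ℤ̂` (definitional). [cite: Milne2005ShimuraVarieties, §4 p. 48] -/
theorem mem_latticeOfGL_iff {a : GL n finAdeleQ} {q : n → ℚ} :
    q ∈ latticeOfGL a ↔ ∀ i, (((a⁻¹ : GL n finAdeleQ) : Matrix n n finAdeleQ) *ᵥ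
      (⇑(algebraMap ℚ finAdeleQ) ∘ q)) i ∈ integralFiniteAdeles ℚ :=
  Iff.rfl

omit [DecidableEq n] in
/-- Integral matrices send integral vectors to integral vectors. [folklore] -/
private theorem mulVec_apply_mem_integralFiniteAdeles {M : Matrix n n finAdeleQ}
    (hM : ∀ i j, M i j ∈ integralFiniteAdeles ℚ) {y : n → finAdeleQ}
    (hy : ∀ j, y j ∈ integralFiniteAdeles ℚ) (i : n) : (M *ᵥ y) i ∈ integralFiniteAdeles ℚ := by
  rw [Matrix.mulVec, dotProduct]
  exact sum_mem fun j _ => mul_mem (hM i j) (hy j)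

/-- `Λ_a = ℚⁿ ∩ a ℤ̂ⁿ`: `q ∈ Λ_a` iff `q = a y` (in `𝔸_{ℚ,f}ⁿ`) for some `y ∈ ℤ̂ⁿ`.
[cite: Milne2005ShimuraVarieties, §4 pp. 48–49] -/
theorem mem_latticeOfGL_iff_exists {a : GL n finAdeleQ} {q : n → ℚ} :
    q ∈ latticeOfGL a ↔ ∃ y : n → finAdeleQ, (∀ j, y j ∈ integralFiniteAdeles ℚ) ∧
      (⇑(algebraMap ℚ finAdeleQ) ∘ q) = (a : Matrix n n finAdeleQ) *ᵥ y := by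
  constructor
  · intro hq
    refine ⟨((a⁻¹ : GL n finAdeleQ) : Matrix n n finAdeleQ) *ᵥ (⇑(algebraMap ℚ finAdeleQ) ∘ q), hq, ?_⟩
    rw [Matrix.mulVec_mulVec, ← Units.val_mul, mul_inv_cancel, Units.val_one, Matrix.one_mulVec]
  · rintro ⟨y, hy, hqy⟩ i
    rw [hqy, Matrix.mulVec_mulVec, ← Units.val_mul, inv_mul_cancel, Units.val_one, Matrix.one_mulVec]
    exact hy i

/-- **`Λ_1 = ℤⁿ`**: the lattice of the identity is the standard lattice (`ℚ ∩ ℤ̂ = ℤ`).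
[cite: Milne2005ShimuraVarieties, §4 p. 48] -/
theorem mem_latticeOfGL_one_iff {q : n → ℚ} :
    q ∈ latticeOfGL (1 : GL n finAdeleQ) ↔ ∀ i, ∃ z : ℤ, (z : ℚ) = q i := by
  rw [mem_latticeOfGL_iff, inv_one, Units.val_one, Matrix.one_mulVec]
  refine forall_congr' fun i => ⟨fun h => exists_int_cast_eq_of_mem_integralFiniteAdeles h, ?_⟩
  rintro ⟨z, hz⟩
  rw [Function.comp_apply, ← hz]
  exact algebraMap_intCast_mem_integralFiniteAdeles z

/-- **Right `GL_n(ℤ̂)`-invariance**: `Λ_{a u} = Λ_a` for `u ∈ GL_n(ℤ̂)`.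
[cite: Milne2005ShimuraVarieties, §4 pp. 48–49] -/
theorem latticeOfGL_mul_eq_of_mem (a : GL n finAdeleQ) {u : GL n finAdeleQ}
    (hu : u ∈ ((integralFiniteAdeles ℚ).matrix.toSubmonoid.units : Subgroup (GL n finAdeleQ))) :
    latticeOfGL (a * u) = latticeOfGL a := by
  rw [mem_units_matrix_integralFiniteAdeles_iff] at hu
  ext q
  rw [mem_latticeOfGL_iff, mem_latticeOfGL_iff, _root_.mul_inv_rev, Units.val_mul, ← Matrix.mulVec_mulVec]
  refine ⟨fun h i => ?_, fun h i => mulVec_apply_mem_integralFiniteAdeles hu.2 h i⟩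
  have h' := mulVec_apply_mem_integralFiniteAdeles hu.1 h i
  rwa [Matrix.mulVec_mulVec, ← Units.val_mul, mul_inv_cancel, Units.val_one, Matrix.one_mulVec] at h'

/-- The adelic image of `γ⁻¹` is the inverse of the adelic image of `γ` (as matrices). [folklore] -/
private theorem coe_generalLinearGroup_map_inv (γ : GL n ℚ) :
    (((Matrix.GeneralLinearGroup.map (algebraMap ℚ finAdeleQ) γ)⁻¹ : GL n finAdeleQ) : Matrix n n finAdeleQ) =
      ((γ⁻¹ : GL n ℚ) : Matrix n n ℚ).map (algebraMap ℚ finAdeleQ) := by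
  rw [← map_inv]; rfl

omit [DecidableEq n] in
/-- `f ∘ (M q) = (M.map f) (f ∘ q)` for the diagonal embedding `f : ℚ → 𝔸_{ℚ,f}`. [folklore] -/
private theorem algebraMap_comp_mulVec (M : Matrix n n ℚ) (q : n → ℚ) :
    (⇑(algebraMap ℚ finAdeleQ) ∘ (M *ᵥ q)) = M.map (algebraMap ℚ finAdeleQ) *ᵥ (⇑(algebraMap ℚ finAdeleQ) ∘ q) := by
  funext i
  exact RingHom.map_mulVec (algebraMap ℚ finAdeleQ) M q i

/-- **Left `GL_n(ℚ)`-equivariance**: `q ∈ Λ_{γ a} ↔ γ⁻¹ q ∈ Λ_a`, i.e. `Λ_{γ a} = γ • Λ_a`.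
[cite: Milne2005ShimuraVarieties, §4 pp. 48–49] -/
theorem mem_latticeOfGL_map_mul_iff (γ : GL n ℚ) (a : GL n finAdeleQ) (q : n → ℚ) :
    q ∈ latticeOfGL (Matrix.GeneralLinearGroup.map (algebraMap ℚ finAdeleQ) γ * a) ↔
      ((γ⁻¹ : GL n ℚ) : Matrix n n ℚ) *ᵥ q ∈ latticeOfGL a := by
  rw [mem_latticeOfGL_iff, mem_latticeOfGL_iff, _root_.mul_inv_rev, Units.val_mul, ← Matrix.mulVec_mulVec,
    coe_generalLinearGroup_map_inv, ← algebraMap_comp_mulVec]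

/-- `γ q ∈ Λ_{γ a}` for `q ∈ Λ_a`. [cite: Milne2005ShimuraVarieties, §4 pp. 48–49] -/
theorem mulVec_mem_latticeOfGL_map_mul (γ : GL n ℚ) {a : GL n finAdeleQ} {q : n → ℚ} (hq : q ∈ latticeOfGL a) :
    (γ : Matrix n n ℚ) *ᵥ q ∈ latticeOfGL (Matrix.GeneralLinearGroup.map (algebraMap ℚ finAdeleQ) γ * a) := by
  rw [mem_latticeOfGL_map_mul_iff, Matrix.mulVec_mulVec, ← Units.val_mul, inv_mul_cancel, Units.val_one,
    Matrix.one_mulVec]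
  exact hq

/-- `Λ_{γ a} = γ • Λ_a` as `ℤ`-submodules of `ℚⁿ` (image under the `ℤ`-linear map `q ↦ γ q`).
[cite: Milne2005ShimuraVarieties, §4 pp. 48–49] -/
theorem latticeOfGL_map_mul (γ : GL n ℚ) (a : GL n finAdeleQ) :
    latticeOfGL (Matrix.GeneralLinearGroup.map (algebraMap ℚ finAdeleQ) γ * a) =
      (latticeOfGL a).map (((γ : Matrix n n ℚ).mulVecLin).restrictScalars ℤ) := by
  ext q
  rw [Submodule.mem_map, mem_latticeOfGL_map_mul_iff]
  constructor
  · intro h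
    refine ⟨_, h, ?_⟩
    rw [LinearMap.restrictScalars_apply, Matrix.mulVecLin_apply, Matrix.mulVec_mulVec, ← Units.val_mul,
      mul_inv_cancel, Units.val_one, Matrix.one_mulVec]
  · rintro ⟨p, hp, rfl⟩
    rw [LinearMap.restrictScalars_apply, Matrix.mulVecLin_apply, Matrix.mulVec_mulVec, ← Units.val_mul,
      inv_mul_cancel, Units.val_one, Matrix.one_mulVec]
    exact hp

/-- **`Λ_γ = γ ℤⁿ`** for `γ ∈ GL_n(ℚ)`: `q ∈ Λ_γ ↔ γ⁻¹ q ∈ ℤⁿ`. [cite: Milne2005ShimuraVarieties, §4 p. 48] -/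
theorem mem_latticeOfGL_map_iff (γ : GL n ℚ) (q : n → ℚ) :
    q ∈ latticeOfGL (Matrix.GeneralLinearGroup.map (algebraMap ℚ finAdeleQ) γ) ↔
      ∀ i, ∃ z : ℤ, (z : ℚ) = (((γ⁻¹ : GL n ℚ) : Matrix n n ℚ) *ᵥ q) i := by
  rw [← mul_one (Matrix.GeneralLinearGroup.map (algebraMap ℚ finAdeleQ) γ), mem_latticeOfGL_map_mul_iff,
    mem_latticeOfGL_one_iff]

/-- **`Λ_γ = γ ℤⁿ`**, parametrised: `q ∈ Λ_γ ↔ q = γ z` for an integer vector `z`.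
[cite: Milne2005ShimuraVarieties, §4 p. 48] -/
theorem mem_latticeOfGL_map_iff_exists (γ : GL n ℚ) (q : n → ℚ) :
    q ∈ latticeOfGL (Matrix.GeneralLinearGroup.map (algebraMap ℚ finAdeleQ) γ) ↔
      ∃ z : n → ℤ, q = (γ : Matrix n n ℚ) *ᵥ fun j => (z j : ℚ) := by
  rw [mem_latticeOfGL_map_iff]
  constructor
  · intro h
    choose z hz using h
    refine ⟨z, ?_⟩
    have : (fun j => (z j : ℚ)) = ((γ⁻¹ : GL n ℚ) : Matrix n n ℚ) *ᵥ q := funext hz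
    rw [this, Matrix.mulVec_mulVec, ← Units.val_mul, mul_inv_cancel, Units.val_one, Matrix.one_mulVec]
  · rintro ⟨z, rfl⟩ i
    refine ⟨z i, ?_⟩
    rw [Matrix.mulVec_mulVec, ← Units.val_mul, inv_mul_cancel, Units.val_one, Matrix.one_mulVec]


/-! ### §1b. Two bookkeeping identities -/

omit [Fintype n] in
/-- The diagonal embedding of a standard vector is the standard vector. [folklore] -/
private theorem algebraMap_comp_single (j : n) :
    (⇑(algebraMap ℚ finAdeleQ) ∘ (Pi.single j 1 : n → ℚ)) = (Pi.single j 1 : n → finAdeleQ) := by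
  classical
  funext k
  by_cases hk : k = j
  · subst hk; simp
  · simp [hk]

/-- The `(i, j)` entry of `M` is the `i`-th coordinate of `M eⱼ`. [folklore] -/
private theorem matrix_apply_eq_mulVec_single (M : Matrix n n finAdeleQ) (i j : n) :
    M i j = (M *ᵥ (Pi.single j 1 : n → finAdeleQ)) i := by
  classical
  simp [Matrix.mulVec, dotProduct, Pi.single_apply]

/-! ### §2. Denominators: `N eᵢ ∈ Λ_a` and `N Λ_a ⊆ ℤⁿ` for a common denominator `N` of `a`, `a⁻¹` -/

/-- A non-zero integer of `ℚ` clearing denominators may be taken in `ℕ`. [folklore] -/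
private theorem exists_nat_of_ringOfIntegers_mul_mem (N₀ : 𝓞 ℚ) (hN₀ : N₀ ≠ 0) :
    ∃ N : ℕ, N ≠ 0 ∧ ∀ x : finAdeleQ,
      algebraMap (𝓞 ℚ) finAdeleQ N₀ * x ∈ integralFiniteAdeles ℚ → (N : finAdeleQ) * x ∈ integralFiniteAdeles ℚ := by
  set z : ℤ := Rat.ringOfIntegersEquiv N₀ with hzdef
  refine ⟨z.natAbs, ?_, fun x hx => ?_⟩
  · intro h
    apply hN₀
    have : Rat.ringOfIntegersEquiv N₀ = 0 := Int.natAbs_eq_zero.mp h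
    exact Rat.ringOfIntegersEquiv.injective (by rw [this, map_zero])
  · have hN₀A : algebraMap (𝓞 ℚ) finAdeleQ N₀ = algebraMap ℚ finAdeleQ (z : ℚ) := by
      rw [IsScalarTower.algebraMap_apply (𝓞 ℚ) ℚ finAdeleQ, hzdef, Rat.ringOfIntegersEquiv_apply_coe]
    rw [hN₀A] at hx
    have hNz : ((z.natAbs : ℕ) : finAdeleQ) = algebraMap ℚ finAdeleQ ((z.natAbs : ℤ) : ℚ) := by
      rw [Int.cast_natCast, map_natCast]
    rcases le_total 0 z with h0 | h0
    · rw [hNz, Int.natAbs_of_nonneg h0]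
      exact hx
    · rw [hNz, Int.ofNat_natAbs_of_nonpos h0, Int.cast_neg, map_neg, neg_mul]
      exact neg_mem hx

/-- **Common denominator of `a` and `a⁻¹`**: some `N ≥ 1` makes `N a` and `N a⁻¹` integral.
[cite: PlatonovRapinchuk1994, §8.1] -/
theorem exists_nat_mul_entries_mem (a : GL n finAdeleQ) :
    ∃ N : ℕ, N ≠ 0 ∧ (∀ i j, (N : finAdeleQ) * (a : Matrix n n finAdeleQ) i j ∈ integralFiniteAdeles ℚ) ∧
      ∀ i j, (N : finAdeleQ) * ((a⁻¹ : GL n finAdeleQ) : Matrix n n finAdeleQ) i j ∈ integralFiniteAdeles ℚ := by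
  classical
  obtain ⟨N₀, hN₀, hden⟩ := exists_ne_zero_forall_mul_entry_mem (n := n) ℚ ({a, a⁻¹} : Finset (GL n finAdeleQ))
  obtain ⟨N, hN, hNmul⟩ := exists_nat_of_ringOfIntegers_mul_mem N₀ hN₀
  exact ⟨N, hN, fun i j => hNmul _ (hden a (by simp) i j), fun i j => hNmul _ (hden a⁻¹ (by simp) i j)⟩

/-- `N eᵢ ∈ Λ_a` as soon as `N a⁻¹` is integral. [cite: Milne2005ShimuraVarieties, §4 p. 48] -/
theorem natCast_smul_single_mem_latticeOfGL {a : GL n finAdeleQ} {N : ℕ}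
    (hN : ∀ i j, (N : finAdeleQ) * ((a⁻¹ : GL n finAdeleQ) : Matrix n n finAdeleQ) i j ∈ integralFiniteAdeles ℚ)
    (i : n) : ((N : ℚ) • Pi.single i 1 : n → ℚ) ∈ latticeOfGL a := by
  intro k
  have h : (⇑(algebraMap ℚ finAdeleQ) ∘ ((N : ℚ) • Pi.single i 1 : n → ℚ)) =
      fun j => (Pi.single i (N : finAdeleQ) : n → finAdeleQ) j := by
    funext j
    by_cases hj : j = i
    · subst hj; simp
    · simp [hj]
  rw [h]
  have : (((a⁻¹ : GL n finAdeleQ) : Matrix n n finAdeleQ) *ᵥ fun j => (Pi.single i (N : finAdeleQ) : n → finAdeleQ) j) k =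
      (N : finAdeleQ) * ((a⁻¹ : GL n finAdeleQ) : Matrix n n finAdeleQ) k i := by
    simp [Matrix.mulVec, dotProduct, Pi.single_apply, mul_comm]
  rw [this]
  exact hN k i

/-- `N Λ_a ⊆ ℤⁿ` as soon as `N a` is integral. [cite: Milne2005ShimuraVarieties, §4 p. 48] -/
theorem exists_int_cast_eq_natCast_mul_of_mem_latticeOfGL {a : GL n finAdeleQ} {N : ℕ}
    (hN : ∀ i j, (N : finAdeleQ) * (a : Matrix n n finAdeleQ) i j ∈ integralFiniteAdeles ℚ)
    {q : n → ℚ} (hq : q ∈ latticeOfGL a) (i : n) : ∃ z : ℤ, (z : ℚ) = N * q i := by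
  obtain ⟨y, hy, hqy⟩ := mem_latticeOfGL_iff_exists.mp hq
  apply exists_int_cast_eq_of_mem_integralFiniteAdeles
  have hqi : algebraMap ℚ finAdeleQ (q i) = ((a : Matrix n n finAdeleQ) *ᵥ y) i := congrFun hqy i
  rw [map_mul, map_natCast, hqi, Matrix.mulVec, dotProduct, Finset.mul_sum]
  exact sum_mem fun j _ => by
    rw [← mul_assoc]
    exact mul_mem (hN i j) (hy j)

end Literature.NumberTheory.Adeles

end
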